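import Summits.HodgeConjecture.HodgeConjecture.Theorems.TropicalKugaSatakeCayleyFormalCycleCriterionCycleClassRational
import Summits.HodgeConjecture.HodgeConjecture.Theorems.TropicalKugaSatakeCayleyFormalCycleCriterionIsCycleOfIncidences
import Summits.HodgeConjecture.HodgeConjecture.Theorems.TropicalWeilObstructionGenericWeilPeriod
import Literature.AlgebraicGeometry.Tropical.KugaSatakeLinearFamily
import HarnessLib

/-!
# Crux `EffectiveCayleyNonRealizability` (stmt-HodgeConjecture-18569), line `formal_rational` —
# registered stub 2 `stub_identityPrinciple`, PROVED: the identity principle for formal chains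

Route `TropicalKugaSatakeCayley` of `HodgeConjecture`. Stub 2 of the registered skeleton
`Cruxes/EffectiveCayleyNonRealizability/Lines/formal_rational.lean`: for a formal framed `2`-chain
`𝒵` over `ℚ[t₀,…,t₄]` which, at every parameter `t` of a non-empty open `V ⊆ ksPosCone`, evaluates
to a tropical cycle of `ℝ⁸ / B_t ℤ⁸` (`B_t = ksMatrix t`) with period class `M`:
(a) `𝒵` is a cycle FORMALLY, i.e. w.r.t. the period matrix of linear forms `Σ_i t_i • ksForm i`
over the polynomial ring; (b) `M` is a rational matrix; (c) `V` contains a rational parameter.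

Proof.
* BASE CHANGE OF THE CYCLE CONDITION (`boundaryCoeff_map`, `isCycle_of_isCycle_map`; any `g`, `p`,
  any INJECTIVE `ℚ`-algebra map `φ : S → S'`): mapping the base vertices and edge coefficients of
  every cell by `φ` maps vertices and ordered faces by `φ` (`face_mapCell`), and two ordered tuples
  are translates by `Per ℤ^g` iff their images are translates by `φ(Per) ℤ^g`
  (`isTranslate_map_iff`: one direction is `φ` applied to the identity, the other is injectivity of
  `φ` applied to `τ' = τ + Per k` coordinatewise, with the SAME integer vector `k`). Hence the
  boundary coefficient of the mapped chain at `φ ∘ τ` is the boundary coefficient of the chain at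
  `τ` (same incident face indices, same rational framings), and the cycle condition descends along
  `φ`.
* GENERIC POINTS (`exists_algebraicIndependent_mem`): every non-empty open subset of `ℝ⁵` contains a
  point `t` with algebraically independent coordinates (an algebraically independent `5`-tuple of
  small reals, `GenericWeilPeriod.exists_algebraicIndependent_real_small`, shifted by rationals close
  to a point of the set, `GenericWeilPeriod.algebraicIndependent_affine`); at such `t` the evaluation
  `aeval t : ℚ[t₀,…,t₄] → ℝ` is injective and maps `Σ_i t_i • ksForm i` to `B_t`
  (`ksMatrixPoly_map_aeval`), so (a) follows from the base change at one generic `t ∈ V`.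
* (b) is the rationality of period classes of tropical `2`-cycles
  (`FormalCycleCriterion.cycleClassRational`, discrete Stokes) at any `t ∈ V`; (c) is density of
  `ℚ⁵` in `ℝ⁵` (`exists_rat_mem`).

The affine-linearity hypothesis of the registered signature is not used. No named fact, no new
definition, no sorry. The last theorem `identityPrinciple` is the REGISTERED SIGNATURE with the
skeleton-local `evalChain` / `evalCell` / `ksMatrixPoly` unfolded verbatim (the skeleton's
`stub_identityPrinciple` is `fun 𝒵 _ V hVo hVne hV M h => identityPrinciple 𝒵 V hVo hVne hV M h`).
References: [Zharkov2020TropicalWeil] I. Zharkov, Tropical abelian varieties, Weil classes and the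
Hodge conjecture, arXiv:2002.02347, p. 3 ("cycles which vary rationally over the space of
parameters"); [MikhalkinZharkov2014Eigenwave] G. Mikhalkin, I. Zharkov, Tropical eigenwave and
intermediate Jacobians, LN UMI 15 (2014), Def. 4.2, Prop. 4.3.
-/

noncomputable section

-- `Summit.HodgeConjecture.HodgeConjecture.…` is the mandated namespace (single-conjunct summit).
set_option linter.dupNamespace false

open scoped BigOperators
open Matrix

namespace Summit.HodgeConjecture.HodgeConjecture.Theorems.EffectiveCayleyNonRealizability

open Literature.AlgebraicGeometry.Tropical
open Literature.AlgebraicGeometry.Tropical.TropicalTorus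
open Summit.HodgeConjecture.HodgeConjecture.Theorems.FormalCycleCriterion

/-! ### Base change of framed chains along a `ℚ`-algebra map -/

section BaseChange

variable {S S' : Type*} [CommRing S] [CommRing S'] [Algebra ℚ S] [Algebra ℚ S'] {g p : ℕ}

/-- Mapping base vertex and edge coefficients of a framed cell by a `ℚ`-algebra map `φ` maps every
edge vector by `φ` (the direction frame is rational). [folklore] -/
theorem edge_mapCell (φ : S →ₐ[ℚ] S') (c : Cell S g p) (i : Fin p) (r : Fin g) :
    (⟨fun r => φ (c.base r), c.dir, fun i j => φ (c.coef i j), c.weight⟩ : Cell S' g p).edge i r =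
      φ (c.edge i r) := by
  simp only [Cell.edge, map_sum, map_mul, AlgHom.commutes]

/-- … hence maps every vertex by `φ`. [folklore] -/
theorem vertex_mapCell (φ : S →ₐ[ℚ] S') (c : Cell S g p) (j : Fin (p + 1)) (r : Fin g) :
    (⟨fun r => φ (c.base r), c.dir, fun i j => φ (c.coef i j), c.weight⟩ : Cell S' g p).vertex j r =
      φ (c.vertex j r) := by
  refine Fin.cases ?_ (fun i => ?_) j
  · rfl
  · simp only [Cell.vertex, Fin.cases_succ, Pi.add_apply, map_add, edge_mapCell]

/-- … hence maps every ordered face (composed with any permutation of its vertices) by `φ`.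
[folklore] -/
theorem face_mapCell (φ : S →ₐ[ℚ] S') (c : Cell S g p) (i : Fin (p + 1)) (π : Equiv.Perm (Fin p)) :
    ((⟨fun r => φ (c.base r), c.dir, fun i j => φ (c.coef i j), c.weight⟩ : Cell S' g p).face i ∘ π) =
      fun j r => φ ((c.face i ∘ π) j r) := by
  funext j r
  exact vertex_mapCell φ c (i.succAbove (π j)) r

/-- The framing `weight · (D₁ ∧ … ∧ D_p)` of a cell is unchanged by base change (it only involves the
rational frame and weight). [folklore] -/
theorem framing_mapCell (φ : S →ₐ[ℚ] S') (c : Cell S g p) :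
    (⟨fun r => φ (c.base r), c.dir, fun i j => φ (c.coef i j), c.weight⟩ : Cell S' g p).framing =
      c.framing := rfl

/-- A `ℚ`-algebra map applied to a period vector `Per · k` (`k` integral) is the period vector of the
mapped period matrix. [folklore] -/
theorem map_mulVec_intCast (φ : S →ₐ[ℚ] S') (Per : Matrix (Fin g) (Fin g) S) (k : Fin g → ℤ)
    (r : Fin g) :
    φ ((Per *ᵥ fun s => (k s : S)) r) = (Per.map φ *ᵥ fun s => (k s : S')) r := by
  simp only [Matrix.mulVec, dotProduct, map_sum, map_mul, map_intCast, Matrix.map_apply]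

/-- Period translates map to period translates: `τ' = τ + Per k` gives `φτ' = φτ + φ(Per) k` with the
same integer vector `k`. [folklore] -/
theorem isTranslate_map (φ : S →ₐ[ℚ] S') {Per : Matrix (Fin g) (Fin g) S} {τ τ' : Fin p → Fin g → S}
    (h : IsTranslate Per τ τ') :
    IsTranslate (Per.map φ) (fun j r => φ (τ j r)) (fun j r => φ (τ' j r)) := by
  obtain ⟨k, hk⟩ := h
  refine ⟨k, fun j => funext fun r => ?_⟩
  have h1 := congr_fun (hk j) r
  show φ (τ' j r) = φ (τ j r) + (Per.map φ *ᵥ fun s => (k s : S')) r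
  rw [h1, Pi.add_apply, map_add, map_mulVec_intCast]

/-- Conversely, along an INJECTIVE `φ`, `φτ' = φτ + φ(Per) k` lifts to `τ' = τ + Per k`. [folklore] -/
theorem isTranslate_of_map (φ : S →ₐ[ℚ] S') (hφ : Function.Injective φ)
    {Per : Matrix (Fin g) (Fin g) S} {τ τ' : Fin p → Fin g → S}
    (h : IsTranslate (Per.map φ) (fun j r => φ (τ j r)) (fun j r => φ (τ' j r))) :
    IsTranslate Per τ τ' := by
  obtain ⟨k, hk⟩ := h
  refine ⟨k, fun j => funext fun r => hφ ?_⟩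
  have h1 := congr_fun (hk j) r
  simp only [Pi.add_apply] at h1
  rw [h1, Pi.add_apply, map_add, map_mulVec_intCast]

/-- Along an injective `ℚ`-algebra map, "`Per`-translate" and "`φ(Per)`-translate of the images" are
equivalent. [folklore] -/
theorem isTranslate_map_iff (φ : S →ₐ[ℚ] S') (hφ : Function.Injective φ)
    (Per : Matrix (Fin g) (Fin g) S) (τ τ' : Fin p → Fin g → S) :
    IsTranslate (Per.map φ) (fun j r => φ (τ j r)) (fun j r => φ (τ' j r)) ↔ IsTranslate Per τ τ' :=
  ⟨isTranslate_of_map φ hφ, isTranslate_map φ⟩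

open Classical in
/-- **The boundary coefficient is invariant under injective base change.** For a framed chain `Z`
over `S`, an injective `ℚ`-algebra map `φ : S → S'` and any ordered tuple `τ`, the boundary
coefficient of the mapped chain (cells with base and coefficients mapped by `φ`) at `φ ∘ τ`, w.r.t.
the period matrix `φ(Per)`, equals the boundary coefficient of `Z` at `τ` w.r.t. `Per`: the incident
face indices are the same (`isTranslate_map_iff`, `face_mapCell`) and so are the signed framings.
[cite: Zharkov2020TropicalWeil, p. 2] -/
theorem boundaryCoeff_map (φ : S →ₐ[ℚ] S') (hφ : Function.Injective φ) (Per : Matrix (Fin g) (Fin g) S)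
    (Z : Chain S g p) (τ : Fin p → Fin g → S) :
    (⟨Z.size, fun c => ⟨fun r => φ ((Z.cell c).base r), (Z.cell c).dir,
        fun i j => φ ((Z.cell c).coef i j), (Z.cell c).weight⟩⟩ : Chain S' g p).boundaryCoeff
        (Per.map φ) (fun j r => φ (τ j r)) =
      Z.boundaryCoeff Per τ := by
  simp only [Chain.boundaryCoeff]
  refine Finset.sum_congr rfl fun c _ => Finset.sum_congr rfl fun i _ =>
    Finset.sum_congr rfl fun π _ => ?_
  have hface : ((⟨fun r => φ ((Z.cell c).base r), (Z.cell c).dir,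
      fun i j => φ ((Z.cell c).coef i j), (Z.cell c).weight⟩ : Cell S' g p).face i ∘ π) =
      fun j r => φ (((Z.cell c).face i ∘ π) j r) := face_mapCell φ (Z.cell c) i π
  rw [hface, isTranslate_map_iff φ hφ]
  rfl

/-- **The cycle condition descends along injective base change.** If the mapped chain is a
tropical cycle of `S'^g / φ(Per) ℤ^g`, then `Z` is a tropical cycle of `S^g / Per ℤ^g` (evaluate
the vanishing boundary at the image tuples `φ ∘ τ`). [cite: Zharkov2020TropicalWeil, p. 2] -/
theorem isCycle_of_isCycle_map (φ : S →ₐ[ℚ] S') (hφ : Function.Injective φ)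
    (Per : Matrix (Fin g) (Fin g) S) (Z : Chain S g p)
    (hZ : (⟨Z.size, fun c => ⟨fun r => φ ((Z.cell c).base r), (Z.cell c).dir,
        fun i j => φ ((Z.cell c).coef i j), (Z.cell c).weight⟩⟩ : Chain S' g p).IsCycle (Per.map φ)) :
    Z.IsCycle Per := by
  intro τ
  rw [← boundaryCoeff_map φ hφ Per Z τ]
  exact hZ _

/-- Boundary coefficients only depend on the translate class of the tuple. [folklore] -/
theorem boundaryCoeff_eq_of_isTranslate (Per : Matrix (Fin g) (Fin g) S) (Z : Chain S g p)
    {τ₁ τ₂ : Fin p → Fin g → S} (h : IsTranslate Per τ₁ τ₂) :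
    Z.boundaryCoeff Per τ₁ = Z.boundaryCoeff Per τ₂ := by
  classical
  simp only [Chain.boundaryCoeff]
  refine Finset.sum_congr rfl fun c _ => Finset.sum_congr rfl fun i _ =>
    Finset.sum_congr rfl fun π _ => ?_
  have hiff : IsTranslate Per τ₁ ((Z.cell c).face i ∘ π) ↔ IsTranslate Per τ₂ ((Z.cell c).face i ∘ π) :=
    ⟨fun h₁ => isTranslate_trans (isTranslate_symm h) h₁, fun h₂ => isTranslate_trans h h₂⟩
  rw [if_congr hiff rfl rfl]

/-- **… and ascends along it**: if `Z` is a tropical cycle of `S^g / Per ℤ^g` then the mapped chain is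
a tropical cycle of `S'^g / φ(Per) ℤ^g` (a tuple of `S'^g` not incident to any mapped face has
boundary coefficient `0`; one incident to the mapped face `φ ∘ f` has the boundary coefficient of the
mapped chain at `φ ∘ f`, which is that of `Z` at `f`). So the cycle condition is EQUIVALENT to the
cycle condition after any injective base change. [cite: Zharkov2020TropicalWeil, p. 2] -/
theorem isCycle_map_iff (φ : S →ₐ[ℚ] S') (hφ : Function.Injective φ)
    (Per : Matrix (Fin g) (Fin g) S) (Z : Chain S g p) :
    (⟨Z.size, fun c => ⟨fun r => φ ((Z.cell c).base r), (Z.cell c).dir,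
        fun i j => φ ((Z.cell c).coef i j), (Z.cell c).weight⟩⟩ : Chain S' g p).IsCycle (Per.map φ) ↔
      Z.IsCycle Per := by
  classical
  refine ⟨isCycle_of_isCycle_map φ hφ Per Z, fun hZ τ' => ?_⟩
  set Z' : Chain S' g p := ⟨Z.size, fun c => ⟨fun r => φ ((Z.cell c).base r), (Z.cell c).dir,
    fun i j => φ ((Z.cell c).coef i j), (Z.cell c).weight⟩⟩ with hZ'
  by_cases hex : ∃ c : Fin Z.size, ∃ i : Fin (p + 1), ∃ π : Equiv.Perm (Fin p),
      IsTranslate (Per.map φ) τ' ((Z'.cell c).face i ∘ π)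
  · -- `τ'` is incident to a mapped face `φ ∘ f`: reduce to `boundaryCoeff_map` at `f`
    obtain ⟨c, i, π, hinc⟩ := hex
    have hface : ((Z'.cell c).face i ∘ π) = fun j r => φ (((Z.cell c).face i ∘ π) j r) :=
      face_mapCell φ (Z.cell c) i π
    rw [boundaryCoeff_eq_of_isTranslate (Per.map φ) Z' hinc, hface, hZ']
    rw [boundaryCoeff_map φ hφ Per Z]
    exact hZ _
  · -- `τ'` is incident to no face: every summand vanishes
    push Not at hex
    simp only [Chain.boundaryCoeff]
    refine Finset.sum_eq_zero fun c _ => Finset.sum_eq_zero fun i _ =>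
      Finset.sum_eq_zero fun π _ => ?_
    rw [if_neg (hex c i π)]

end BaseChange

/-! ### The Kuga–Satake family: evaluation of the generic period matrix, generic and rational points -/

section KS

/-- Evaluating the period matrix of linear forms `Σ_i t_i • ksForm i ∈ M₈(ℚ[t₀,…,t₄])` at `t ∈ ℝ⁵`
gives `B_t = ksMatrix t`. [folklore] -/
theorem ksMatrixPoly_map_aeval (t : Fin 5 → ℝ) :
    (∑ i : Fin 5, (MvPolynomial.X i : MvPolynomial (Fin 5) ℚ) •
        (ksForm i).map (Int.cast : ℤ → MvPolynomial (Fin 5) ℚ)).map (MvPolynomial.aeval t) =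
      ksMatrix t := by
  ext r s
  simp only [ksMatrix, Matrix.map_apply, Matrix.sum_apply, Matrix.smul_apply, smul_eq_mul, map_sum,
    map_mul, MvPolynomial.aeval_X, map_intCast]

/-- At a parameter with algebraically independent coordinates the evaluation map
`aeval t : ℚ[t₀,…,t₄] → ℝ` is injective. [folklore] -/
theorem injective_aeval_of_algebraicIndependent {t : Fin 5 → ℝ} (ht : AlgebraicIndependent ℚ t) :
    Function.Injective (MvPolynomial.aeval t : MvPolynomial (Fin 5) ℚ →ₐ[ℚ] ℝ) :=
  algebraicIndependent_iff_injective_aeval.1 ht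

/-- **Every non-empty open subset of `ℝ^ι` (`ι` finite) contains a point with algebraically
independent coordinates**: shift a small algebraically independent tuple by rationals close to a
point of the set. [folklore] -/
theorem exists_algebraicIndependent_mem {ι : Type} [Fintype ι] {V : Set (ι → ℝ)} (hV : IsOpen V)
    (hne : V.Nonempty) : ∃ t ∈ V, AlgebraicIndependent ℚ t := by
  obtain ⟨v, hv⟩ := hne
  obtain ⟨ε, hε, hball⟩ := Metric.isOpen_iff.1 hV v hv
  obtain ⟨x, hx, hxs⟩ := GenericWeilPeriod.exists_algebraicIndependent_real_small ι
    (half_pos (half_pos hε))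
  -- rationals `c i` with `|v i - c i| < ε / 2`
  have hc : ∀ i, ∃ c : ℚ, |v i - c| < ε / 2 := fun i => by
    obtain ⟨c, hc1, hc2⟩ := exists_rat_btwn (show v i - ε / 2 < v i by linarith)
    exact ⟨c, by rw [abs_lt]; constructor <;> linarith⟩
  choose c hc using hc
  refine ⟨fun i => ((1 : ℚ) : ℝ) * x i + c i, hball ?_,
    GenericWeilPeriod.algebraicIndependent_affine hx (fun _ => 1) c fun _ => one_ne_zero⟩
  rw [Metric.mem_ball, dist_pi_lt_iff hε]
  intro i
  rw [Real.dist_eq, Rat.cast_one, one_mul]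
  have h1 := hxs i
  have h2 := hc i
  calc |x i + ↑(c i) - v i| = |x i + (↑(c i) - v i)| := by ring_nf
    _ ≤ |x i| + |↑(c i) - v i| := abs_add_le _ _
    _ < ε := by rw [abs_sub_comm] at h2; linarith

/-- Every non-empty open subset of `ℝ^ι` (`ι` finite) contains a rational point. [folklore] -/
theorem exists_rat_mem {ι : Type} [Fintype ι] {V : Set (ι → ℝ)} (hV : IsOpen V) (hne : V.Nonempty) :
    ∃ q : ι → ℚ, (fun i => (q i : ℝ)) ∈ V := by
  obtain ⟨v, hv⟩ := hne
  obtain ⟨ε, hε, hball⟩ := Metric.isOpen_iff.1 hV v hv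
  have hc : ∀ i, ∃ c : ℚ, |v i - c| < ε := fun i => by
    obtain ⟨c, hc1, hc2⟩ := exists_rat_btwn (show v i - ε < v i by linarith)
    exact ⟨c, by rw [abs_lt]; constructor <;> linarith⟩
  choose c hc using hc
  refine ⟨c, hball ?_⟩
  rw [Metric.mem_ball, dist_pi_lt_iff hε]
  intro i
  rw [Real.dist_eq, abs_sub_comm]
  exact hc i

end KS

/-! ### The identity principle -/

/-- **The identity principle for formal chains of the Kuga–Satake family** (general form: no
affine-linearity needed). Let `𝒵` be a framed `2`-chain over `ℚ[t₀,…,t₄]` whose evaluation at every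
`t` of a non-empty open `V ⊆ ksPosCone` is a tropical cycle of `ℝ⁸ / B_t ℤ⁸` with period class `M`.
Then (a) `𝒵` is FORMALLY a cycle, w.r.t. the period matrix `Σ_i t_i • ksForm i` over the polynomial
ring — by base change of the cycle condition along the evaluation at ONE point of `V` with
algebraically independent coordinates (injective); (b) `M` is rational (period classes of tropical
`2`-cycles are rational); (c) `V` contains a rational parameter.
[cite: Zharkov2020TropicalWeil, p. 3] [cite: MikhalkinZharkov2014Eigenwave, Prop. 4.3] -/
theorem identityPrinciple_general (𝒵 : Chain (MvPolynomial (Fin 5) ℚ) 8 2) (V : Set (Fin 5 → ℝ))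
    (hVo : IsOpen V) (hVne : V.Nonempty) (hVcone : V ⊆ ksPosCone) (M : Matrix (Sub 8 2) (Sub 8 2) ℝ)
    (hV : ∀ t ∈ V,
      (⟨𝒵.size, fun c => ⟨fun r => MvPolynomial.aeval t ((𝒵.cell c).base r), (𝒵.cell c).dir,
          fun i j => MvPolynomial.aeval t ((𝒵.cell c).coef i j), (𝒵.cell c).weight⟩⟩ :
          Chain ℝ 8 2).IsCycle (ksMatrix t) ∧
        compound 2 (ksMatrix t)⁻¹ *
          (⟨𝒵.size, fun c => ⟨fun r => MvPolynomial.aeval t ((𝒵.cell c).base r), (𝒵.cell c).dir,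
            fun i j => MvPolynomial.aeval t ((𝒵.cell c).coef i j), (𝒵.cell c).weight⟩⟩ :
            Chain ℝ 8 2).classOf = M) :
    𝒵.IsCycle (∑ i : Fin 5, (MvPolynomial.X i : MvPolynomial (Fin 5) ℚ) •
        (ksForm i).map (Int.cast : ℤ → MvPolynomial (Fin 5) ℚ)) ∧
      (∃ Mq : Matrix (Sub 8 2) (Sub 8 2) ℚ, M = Mq.map (algebraMap ℚ ℝ)) ∧
      ∃ q : Fin 5 → ℚ, (fun i => (q i : ℝ)) ∈ V := by
  obtain ⟨t, htV, ht⟩ := exists_algebraicIndependent_mem hVo hVne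
  refine ⟨?_, ?_, exists_rat_mem hVo hVne⟩
  · -- (a) the formal cycle condition, by injective base change along `aeval t`
    refine isCycle_of_isCycle_map (MvPolynomial.aeval t) (injective_aeval_of_algebraicIndependent ht)
      _ 𝒵 ?_
    rw [ksMatrixPoly_map_aeval]
    exact (hV t htV).1
  · -- (b) rationality of the period class, read at `t`
    obtain ⟨Mq, hMq⟩ := cycleClassRational (ksMatrix t) (hVcone htV) _ (hV t htV).1
    exact ⟨Mq, ((hV t htV).2).symm.trans hMq⟩

/-- **Registered stub `stub_identityPrinciple` of the line `formal_rational`** (crux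
`EffectiveCayleyNonRealizability`, stmt-HodgeConjecture-18569) — the registered signature with the
skeleton-local `evalChain` / `evalCell` / `ksMatrixPoly` unfolded: for an affine-linear formal chain
over `ℚ[t₀,…,t₄]` which at every `t` of a non-empty open `V ⊆ ksPosCone` evaluates to a tropical cycle
of `ℝ⁸ / B_t ℤ⁸` with period class `M`, the chain is formally a cycle, `M` is rational, and `V`
contains a rational parameter. (The affine-linearity hypothesis is not needed.)
[cite: Zharkov2020TropicalWeil, p. 3] [cite: MikhalkinZharkov2014Eigenwave, Prop. 4.3] -/
theorem identityPrinciple :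
    ∀ 𝒵 : Chain (MvPolynomial (Fin 5) ℚ) 8 2, 𝒵.IsAffineLinear →
      ∀ V : Set (Fin 5 → ℝ), IsOpen V → V.Nonempty → V ⊆ ksPosCone →
        ∀ M : Matrix (Sub 8 2) (Sub 8 2) ℝ,
          (∀ t ∈ V,
            (⟨𝒵.size, fun c => ⟨fun r => MvPolynomial.aeval t ((𝒵.cell c).base r), (𝒵.cell c).dir,
                fun i j => MvPolynomial.aeval t ((𝒵.cell c).coef i j), (𝒵.cell c).weight⟩⟩ :
                Chain ℝ 8 2).IsCycle (ksMatrix t) ∧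
              compound 2 (ksMatrix t)⁻¹ *
                (⟨𝒵.size, fun c => ⟨fun r => MvPolynomial.aeval t ((𝒵.cell c).base r),
                    (𝒵.cell c).dir, fun i j => MvPolynomial.aeval t ((𝒵.cell c).coef i j),
                    (𝒵.cell c).weight⟩⟩ : Chain ℝ 8 2).classOf = M) →
          𝒵.IsCycle (∑ i : Fin 5, (MvPolynomial.X i : MvPolynomial (Fin 5) ℚ) •
              (ksForm i).map (Int.cast : ℤ → MvPolynomial (Fin 5) ℚ)) ∧
            (∃ Mq : Matrix (Sub 8 2) (Sub 8 2) ℚ, M = Mq.map (algebraMap ℚ ℝ)) ∧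
            ∃ q : Fin 5 → ℚ, (fun i => (q i : ℝ)) ∈ V :=
  fun 𝒵 _ V hVo hVne hVcone M hV => identityPrinciple_general 𝒵 V hVo hVne hVcone M hV

end Summit.HodgeConjecture.HodgeConjecture.Theorems.EffectiveCayleyNonRealizability

end
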